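import Summits.AtomisticToContinuum.BoseEinsteinCondensation.Theorems.BECSwapNoCatastropheDefs
import Summits.AtomisticToContinuum.BoseEinsteinCondensation.Theorems.BECSwapNoCatastropheTorusHalfSwapOverlapNonVacuity
import Summits.AtomisticToContinuum.BoseEinsteinCondensation.Theorems.BECSwapNoCatastropheTorusHalfSwapOverlapAppendEmbedding
import Summits.AtomisticToContinuum.BoseEinsteinCondensation.Theorems.BECConjugateDominationHardCoreExtensionTruncationEnergyConvergenceAll
import Literature.MathematicalPhysics.QuantumManyBody.PeriodicKineticBudget
import HarnessLib

/-!
# `TorusHalfSwapOverlap` — the TRUNCATION SPLIT (strategist decomposition of crux stmt-AtomisticToContinuum-14393)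

Route `route-AtomisticToContinuum-BECSwapNoCatastrophe`, crux `TorusHalfSwapOverlap` (rank 2). This file
proves, sorry-free, the implication

  `UniformTruncatedChord → HalfSwapTruncationStability → TorusHalfSwapOverlap`

(`TorusHalfSwapOverlap_of_subs`), i.e. a typed split of the crux into two sub-cruxes:

* **`UniformTruncatedChord` (the physics, bounded world).** For every repulsive finite-range `v` the
  integrated no-orthogonality-catastrophe chord bound `|⟨Θ, Φ⟩|² ≥ ½ + η` for `δ`-near-minimisers `Φ` of the
  uncoupled two-copy form `E2(0)` and `Θ` of the half-swapped form `E2(½)` holds for the BOUNDED truncations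
  `v ⊓ m = min(v, m)` with constants `(ρ₀, η, n-threshold, δ)` UNIFORM in the truncation height `m → ∞`
  (`∀ᶠ m` innermost). Every `v ⊓ m` is bounded, so the swap path `s ↦ E2(s)` is non-degenerate (finite on the
  whole `C¹` class; Hellmann–Feynman available) — the regime of rank 3 `TorusSwapPathRigidity`; the hard-core /
  non-integrable branch of the live skeleton (`stub_nonIntegrableChord`, no differential argument) disappears.
* **`HalfSwapTruncationStability` (fixed `n`, functional analysis).** At fixed `(n, L)` the absolute infimum of
  the half-swapped two-copy form is stable under truncation from above:
  `inf E2(½)(v) ≤ inf E2(½)(v ⊓ m) + ε` for all large `m` — the two-copy analogue of Simon's monotone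
  convergence theorem for the one-copy energy, which IS landed for every repulsive finite-range `v`
  (`stub_truncationEnergyConvergenceAll`, Theorems/BECConjugateDominationHardCoreExtensionTruncationEnergyConvergenceAll.lean,
  from the maximal-form bound `maxFormBound_of_isRepulsiveFiniteRange` and Rellich compactness on the torus) and is
  used here for the `E2(0)` half through `inf_{Adm0} E2(0) = 2 E₀^per` (`productUpper` / `productLower`,
  `iInf_E2zero_stability`).

Glue (`midpointChordAt_of_subs`): near-minimisers of the `v`-problems are near-minimisers of the `v ⊓ m`-problems
for `m ≥ m₀(n)` — `E(v ⊓ m) ≤ E(v)` statewise (monotonicity of `v ↦ v^per`) and `inf E(v) ≤ inf E(v ⊓ m) + ε`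
(the two stability facts) — and the overlap does not see `v`; then the landed composition node
`…Birth.stub_cruxOfChord` (bosonic = absolute infimum, swap symmetry, `Ψ ⊗ Ψ`) returns the crux verbatim.

The two sub-cruxes are written (as the binders of `TorusHalfSwapOverlap_of_subs`) with the crux's inlined `let`s over
Literature vocabulary only, so that the route file (which cannot import `Theorems/`) can carry them byte-for-byte as items;
`TorusHalfSwapOverlap_of_subs_folded` is the same implication in the `TwoCopyTorus` vocabulary (definitionally equal).

References: B. Simon, J. Funct. Anal. 28 (1978) 377–385 and J. Operator Theory 1 (1979) 37–47 (monotone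
convergence of quadratic forms); [ReedSimonIV1978] Thm. XIII.64; [LSSY2005] Ch. 2 (dependence of dilute-gas
bounds on `v` through the scattering length only).
-/

noncomputable section

namespace Summit.AtomisticToContinuum.BoseEinsteinCondensation.Cruxes.TorusHalfSwapOverlap.Split

open MeasureTheory Filter
open scoped ENNReal NNReal ComplexConjugate
open Literature.MathematicalPhysics.QuantumManyBody.BoseGas
open Summit.AtomisticToContinuum.BoseEinsteinCondensation.TwoCopyTorus
open Summit.AtomisticToContinuum.BoseEinsteinCondensation.Theses.BECSwapNoCatastrophe (TorusHalfSwapOverlap)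

/-! ## §1 The two sub-cruxes

No `def`s are introduced here (the route file will carry the two statements as items after the split is registered);
they appear below as HYPOTHESES, twice: folded in the `TwoCopyTorus` vocabulary (`midpointChordAt_of_subs`,
`TorusHalfSwapOverlap_of_subs_folded`) and verbatim in the crux's inlined-`let` style over Literature vocabulary only
(`TorusHalfSwapOverlap_of_subs`, whose two binders are byte-for-byte the texts filed as route items; the two readings
agree definitionally).

* **Sub-crux U — `UniformTruncatedChord`.** For every repulsive finite-range `v` there are `ρ₀ > 0` and, for
  `0 < ρ < ρ₀`, an `η > 0` such that for all large `n` some `δ > 0` works for ALL LARGE TRUNCATION HEIGHTS `m`: with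
  `w = v ⊓ m`, every `δ`-near-minimiser `Φ` of the uncoupled two-copy form `E2(0)_w` and every `δ`-near-minimiser `Θ` of
  the half-swapped form `E2(½)_w` on the absolute class `Adm0` (periodic `C¹`, normalised on `cell²`) satisfy
  `|⟨Θ, Φ⟩_{cell²}|² ≥ ½ + η`.
* **Sub-crux S — `HalfSwapTruncationStability`.** For every repulsive finite-range `v`, every `n`, `L > 0` with
  `inf_{Adm0} E2(½)_v < ⊤`, and every `ε > 0`: `inf_{Adm0} E2(½)_v ≤ inf_{Adm0} E2(½)_{v ⊓ m} + ε` for all large `m`.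
-/

/-! ## §3 Fixed-`n` lemmas: monotonicity in the potential, `inf E2(0)` vs `2 E₀`, `E2(0)` stability

(`truncPotential v m = v ⊓ m`, `truncPotential_le : v ⊓ m ≤ v` are the Literature ones, PeriodicBoseGasScatteringODE.lean.) -/

/-- The half-swapped weight is monotone in the potential. [folklore] -/
theorem halfSwapWeight_mono_of_le {w₁ w₂ : ℝ → ℝ≥0∞} (hw : ∀ r, w₁ r ≤ w₂ r) (n : ℕ) (L : ℝ) (Z : Config2 n) :
    halfSwapWeight w₁ n L Z ≤ halfSwapWeight w₂ n L Z := by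
  unfold halfSwapWeight
  gcongr with j _
  · exact periodicInteraction_mono_of_le hw L _
  · exact periodicInteraction_mono_of_le hw L _
  · exact periodizedPotential_mono_of_le hw L _
  · exact periodizedPotential_mono_of_le hw L _
  · exact periodizedPotential_mono_of_le hw L _
  · exact periodizedPotential_mono_of_le hw L _

/-- `E2(½)` is monotone in the potential. [folklore] -/
theorem E2half_mono_of_le {w₁ w₂ : ℝ → ℝ≥0∞} (hw : ∀ r, w₁ r ≤ w₂ r) (n : ℕ) (L : ℝ) (Θ : Config2 n → ℂ) :
    E2half w₁ n L Θ ≤ E2half w₂ n L Θ := by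
  rw [E2half_eq, E2half_eq]
  exact lintegral_mono fun Z => add_le_add le_rfl (mul_le_mul' (halfSwapWeight_mono_of_le hw n L Z) le_rfl)

/-- `E2(0)` is monotone in the potential. [folklore] -/
theorem E2zero_mono_of_le {w₁ w₂ : ℝ → ℝ≥0∞} (hw : ∀ r, w₁ r ≤ w₂ r) (n : ℕ) (L : ℝ) (Θ : Config2 n → ℂ) :
    E2zero w₁ n L Θ ≤ E2zero w₂ n L Θ := by
  unfold E2zero
  exact lintegral_mono fun Z => add_le_add le_rfl
    (mul_le_mul' (add_le_add (periodicInteraction_mono_of_le hw L _) (periodicInteraction_mono_of_le hw L _)) le_rfl)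

/-- **`inf_{Adm0} E2(0) ≤ 2 E₀^per`** (upper half of the product identity, from `productUpper`). [folklore] -/
theorem iInf_E2zero_le_two_mul {v : ℝ → ℝ≥0∞} (hv : IsRepulsiveFiniteRange v) (n : ℕ) (L : ℝ) :
    (⨅ (Θ : Config2 n → ℂ) (_ : Adm0 n L Θ), E2zero v n L Θ) ≤ 2 * periodicGroundStateEnergy v (n + 1) L := by
  unfold periodicGroundStateEnergy
  rw [ENNReal.mul_iInf_of_ne two_ne_zero ENNReal.ofNat_ne_top]
  refine le_iInf fun Ψ => ?_
  obtain ⟨hadm, hE⟩ := productUpper v hv n L Ψ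
  exact (iInf₂_le (fun Z : Config2 n => Ψ.ψ Z.1 * Ψ.ψ Z.2) hadm).trans hE

/-- **`2 E₀^per ≤ inf_{Adm0} E2(0)`** (lower half, from `productLower`). [folklore] -/
theorem two_mul_le_iInf_E2zero {v : ℝ → ℝ≥0∞} (hv : IsRepulsiveFiniteRange v) (n : ℕ) (L : ℝ) :
    2 * periodicGroundStateEnergy v (n + 1) L ≤ ⨅ (Θ : Config2 n → ℂ) (_ : Adm0 n L Θ), E2zero v n L Θ :=
  le_iInf₂ fun Θ hΘ => productLower v hv n L Θ hΘ

/-- **Truncation stability of `inf_{Adm0} E2(0)` at fixed `n`** — from the LANDED one-copy monotone-convergence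
theorem `stub_truncationEnergyConvergenceAll` (`E₀(v) ≤ E₀(v ⊓ m) + ε` eventually) through
`inf E2(0) = 2 E₀`. [cite: ReedSimonIV1978, Thm. XIII.64] -/
theorem iInf_E2zero_stability {v : ℝ → ℝ≥0∞} (hv : IsRepulsiveFiniteRange v) (n : ℕ) {L : ℝ} (hL : 0 < L)
    (hE : periodicGroundStateEnergy v (n + 1) L ≠ ⊤) {ε : ℝ} (hε : 0 < ε) :
    ∃ m₀ : ℕ, ∀ m : ℕ, m₀ ≤ m → (⨅ (Θ : Config2 n → ℂ) (_ : Adm0 n L Θ), E2zero v n L Θ) ≤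
      (⨅ (Θ : Config2 n → ℂ) (_ : Adm0 n L Θ), E2zero (truncPotential v m) n L Θ) + ENNReal.ofReal ε := by
  obtain ⟨m₀, hm₀⟩ :=
    HardCoreExtension.ThirdLawCurrentFloorAlt.stub_truncationEnergyConvergenceAll v hv (n + 1) L hL hE (ε / 2)
      (half_pos hε)
  refine ⟨m₀, fun m hm => ?_⟩
  -- the truncation is again repulsive finite-range (same range)
  have hvm : IsRepulsiveFiniteRange (truncPotential v m) := by
    refine ⟨hv.1.min measurable_const, ?_⟩
    obtain ⟨R₀, hR₀⟩ := hv.2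
    exact ⟨R₀, fun r hr => by simp [truncPotential, hR₀ r hr]⟩
  have h1 : periodicGroundStateEnergy v (n + 1) L ≤
      periodicGroundStateEnergy (truncPotential v m) (n + 1) L + ENNReal.ofReal (ε / 2) := hm₀ m hm
  have hhalf : ENNReal.ofReal (ε / 2) + ENNReal.ofReal (ε / 2) = ENNReal.ofReal ε := by
    rw [← ENNReal.ofReal_add (half_pos hε).le (half_pos hε).le, add_halves]
  calc (⨅ (Θ : Config2 n → ℂ) (_ : Adm0 n L Θ), E2zero v n L Θ)
      ≤ 2 * periodicGroundStateEnergy v (n + 1) L := iInf_E2zero_le_two_mul hv n L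
    _ = periodicGroundStateEnergy v (n + 1) L + periodicGroundStateEnergy v (n + 1) L := two_mul _
    _ ≤ (periodicGroundStateEnergy (truncPotential v m) (n + 1) L + ENNReal.ofReal (ε / 2)) +
          (periodicGroundStateEnergy (truncPotential v m) (n + 1) L + ENNReal.ofReal (ε / 2)) :=
        add_le_add h1 h1
    _ = 2 * periodicGroundStateEnergy (truncPotential v m) (n + 1) L + ENNReal.ofReal ε := by
        rw [← hhalf, two_mul]; abel
    _ ≤ (⨅ (Θ : Config2 n → ℂ) (_ : Adm0 n L Θ), E2zero (truncPotential v m) n L Θ) + ENNReal.ofReal ε :=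
        add_le_add (two_mul_le_iInf_E2zero hvm n L) le_rfl

/-- **Non-vacuity, unconditional** (the landed `stub_nonVacuity` fed with the landed `stub_appendEmbedding`):
for small `ρ` and large `n` the half-swapped and uncoupled absolute infima and `E₀^per` are finite. [folklore] -/
theorem nonVacuity {v : ℝ → ℝ≥0∞} (hv : IsRepulsiveFiniteRange v) :
    ∃ ρ₀ : ℝ, 0 < ρ₀ ∧ ∀ ρ : ℝ, 0 < ρ → ρ < ρ₀ → ∀ᶠ n : ℕ in atTop,
      (⨅ (Θ : Config2 n → ℂ) (_ : Adm0 n (sideLength ρ (n + 1)) Θ), E2half v n (sideLength ρ (n + 1)) Θ) ≠ ⊤ ∧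
        periodicGroundStateEnergy v (n + 1) (sideLength ρ (n + 1)) ≠ ⊤ := by
  obtain ⟨ρ₀, hρ₀, h⟩ := Birth.stub_nonVacuity Birth.stub_appendEmbedding v hv
  refine ⟨ρ₀, hρ₀, fun ρ hρ hρρ₀ => (h ρ hρ hρρ₀).mono fun n hn => ?_⟩
  obtain ⟨-, h2, -, h4⟩ := hn
  exact ⟨ne_of_lt h2, ne_of_lt h4⟩

/-! ## §4 The glue: sub-cruxes ⇒ `MidpointChordAt v` for every `v` ⇒ the crux -/

/-- **The chord for every repulsive finite-range `v` from the two sub-cruxes.** [folklore] -/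
theorem midpointChordAt_of_subs
    (hU : ∀ v : ℝ → ℝ≥0∞, IsRepulsiveFiniteRange v → ∃ ρ₀ : ℝ, 0 < ρ₀ ∧ ∀ ρ : ℝ, 0 < ρ → ρ < ρ₀ →
      ∃ η : ℝ, 0 < η ∧ ∀ᶠ n : ℕ in atTop, ∃ δ : ℝ≥0∞, 0 < δ ∧ ∀ᶠ m : ℕ in atTop,
        ∀ Φ Θ : Config2 n → ℂ,
          Adm0 n (sideLength ρ (n + 1)) Φ →
          E2zero (truncPotential v m) n (sideLength ρ (n + 1)) Φ ≤
            (⨅ (Θ' : Config2 n → ℂ) (_ : Adm0 n (sideLength ρ (n + 1)) Θ'),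
              E2zero (truncPotential v m) n (sideLength ρ (n + 1)) Θ') + δ →
          Adm0 n (sideLength ρ (n + 1)) Θ →
          E2half (truncPotential v m) n (sideLength ρ (n + 1)) Θ ≤
            (⨅ (Θ' : Config2 n → ℂ) (_ : Adm0 n (sideLength ρ (n + 1)) Θ'),
              E2half (truncPotential v m) n (sideLength ρ (n + 1)) Θ') + δ →
          ENNReal.ofReal (1 / 2 + η) ≤
            (‖∫ Z in cell2 n (sideLength ρ (n + 1)), (starRingEnd ℂ) (Θ Z) * Φ Z‖₊ : ENNReal) ^ 2)
    (hS : ∀ v : ℝ → ℝ≥0∞, IsRepulsiveFiniteRange v → ∀ (n : ℕ) (L : ℝ), 0 < L →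
      (⨅ (Θ : Config2 n → ℂ) (_ : Adm0 n L Θ), E2half v n L Θ) ≠ ⊤ → ∀ ε : ℝ, 0 < ε →
        ∃ m₀ : ℕ, ∀ m : ℕ, m₀ ≤ m → (⨅ (Θ : Config2 n → ℂ) (_ : Adm0 n L Θ), E2half v n L Θ) ≤
          (⨅ (Θ : Config2 n → ℂ) (_ : Adm0 n L Θ), E2half (truncPotential v m) n L Θ) + ENNReal.ofReal ε)
    (v : ℝ → ℝ≥0∞) (hv : IsRepulsiveFiniteRange v) : MidpointChordAt v := by
  obtain ⟨ρ₁, hρ₁, hU⟩ := hU v hv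
  obtain ⟨ρ₂, hρ₂, hV⟩ := nonVacuity hv
  refine ⟨min ρ₁ ρ₂, lt_min hρ₁ hρ₂, fun ρ hρ hρlt => ?_⟩
  obtain ⟨η, hη, hUn⟩ := hU ρ hρ (hρlt.trans_le (min_le_left _ _))
  refine ⟨η, hη, ?_⟩
  filter_upwards [hUn, hV ρ hρ (hρlt.trans_le (min_le_right _ _))] with n hn hfin
  obtain ⟨δ, hδ, hUm⟩ := hn
  obtain ⟨hEh, hE0⟩ := hfin
  -- the slack handed to the `v`-problems: half of `δ₀ = min δ 1` (finite and positive)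
  set L : ℝ := sideLength ρ (n + 1) with hLdef
  have hL : 0 < L := sideLength_pos_of_pos hρ (Nat.succ_pos n)
  set δ₀ : ℝ≥0∞ := min δ 1 with hδ₀
  have hδ₀pos : 0 < δ₀ := lt_min hδ one_pos
  have hδ₀top : δ₀ ≠ ⊤ := ne_top_of_le_ne_top ENNReal.one_ne_top (min_le_right _ _)
  have hδ₀le : δ₀ ≤ δ := min_le_left _ _
  have hhalfpos : 0 < δ₀ / 2 := ENNReal.half_pos hδ₀pos.ne'
  have hhalftop : δ₀ / 2 ≠ ⊤ := ENNReal.div_ne_top hδ₀top two_ne_zero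
  set ε : ℝ := (δ₀ / 2).toReal with hεdef
  have hε : 0 < ε := ENNReal.toReal_pos hhalfpos.ne' hhalftop
  have hεeq : ENNReal.ofReal ε = δ₀ / 2 := ENNReal.ofReal_toReal hhalftop
  -- the three thresholds in the truncation height
  obtain ⟨m₁, hm₁⟩ := eventually_atTop.1 hUm
  obtain ⟨m₂, hm₂⟩ := iInf_E2zero_stability hv n hL hE0 hε
  obtain ⟨m₃, hm₃⟩ := hS v hv n L hL hEh ε hε
  set m : ℕ := max m₁ (max m₂ m₃) with hmdef
  have hC := hm₁ m (le_max_left _ _)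
  have hZ := hm₂ m ((le_max_left _ _).trans (le_max_right _ _))
  have hH := hm₃ m ((le_max_right _ _).trans (le_max_right _ _))
  refine ⟨δ₀ / 2, hhalfpos, fun Φ Θ hΦ hΦE hΘ hΘE => hC Φ Θ hΦ ?_ hΘ ?_⟩
  · -- `Φ` is a `δ`-near-minimiser of the truncated uncoupled problem
    calc E2zero (truncPotential v m) n L Φ
        ≤ E2zero v n L Φ := E2zero_mono_of_le (truncPotential_le v m) n L Φ
      _ ≤ (⨅ (Θ' : Config2 n → ℂ) (_ : Adm0 n L Θ'), E2zero v n L Θ') + δ₀ / 2 := hΦE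
      _ ≤ ((⨅ (Θ' : Config2 n → ℂ) (_ : Adm0 n L Θ'), E2zero (truncPotential v m) n L Θ') + ENNReal.ofReal ε) +
            δ₀ / 2 := add_le_add hZ le_rfl
      _ = (⨅ (Θ' : Config2 n → ℂ) (_ : Adm0 n L Θ'), E2zero (truncPotential v m) n L Θ') + δ₀ := by
          rw [hεeq, add_assoc, ENNReal.add_halves]
      _ ≤ (⨅ (Θ' : Config2 n → ℂ) (_ : Adm0 n L Θ'), E2zero (truncPotential v m) n L Θ') + δ :=
          add_le_add le_rfl hδ₀le
  · -- `Θ` is a `δ`-near-minimiser of the truncated half-swapped problem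
    calc E2half (truncPotential v m) n L Θ
        ≤ E2half v n L Θ := E2half_mono_of_le (truncPotential_le v m) n L Θ
      _ ≤ (⨅ (Θ' : Config2 n → ℂ) (_ : Adm0 n L Θ'), E2half v n L Θ') + δ₀ / 2 := hΘE
      _ ≤ ((⨅ (Θ' : Config2 n → ℂ) (_ : Adm0 n L Θ'), E2half (truncPotential v m) n L Θ') + ENNReal.ofReal ε) +
            δ₀ / 2 := add_le_add hH le_rfl
      _ = (⨅ (Θ' : Config2 n → ℂ) (_ : Adm0 n L Θ'), E2half (truncPotential v m) n L Θ') + δ₀ := by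
          rw [hεeq, add_assoc, ENNReal.add_halves]
      _ ≤ (⨅ (Θ' : Config2 n → ℂ) (_ : Adm0 n L Θ'), E2half (truncPotential v m) n L Θ') + δ :=
          add_le_add le_rfl hδ₀le

/-- **The split, folded reading**: sub-crux U → sub-crux S → the crux (the chord for every `v` by
`midpointChordAt_of_subs`, then the landed composition node `…Birth.stub_cruxOfChord`: bosonic = absolute infimum,
swap-symmetric infimum, `Ψ ⊗ Ψ`). [folklore] -/
theorem TorusHalfSwapOverlap_of_subs_folded
    (hU : ∀ v : ℝ → ℝ≥0∞, IsRepulsiveFiniteRange v → ∃ ρ₀ : ℝ, 0 < ρ₀ ∧ ∀ ρ : ℝ, 0 < ρ → ρ < ρ₀ →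
      ∃ η : ℝ, 0 < η ∧ ∀ᶠ n : ℕ in atTop, ∃ δ : ℝ≥0∞, 0 < δ ∧ ∀ᶠ m : ℕ in atTop,
        ∀ Φ Θ : Config2 n → ℂ,
          Adm0 n (sideLength ρ (n + 1)) Φ →
          E2zero (truncPotential v m) n (sideLength ρ (n + 1)) Φ ≤
            (⨅ (Θ' : Config2 n → ℂ) (_ : Adm0 n (sideLength ρ (n + 1)) Θ'),
              E2zero (truncPotential v m) n (sideLength ρ (n + 1)) Θ') + δ →
          Adm0 n (sideLength ρ (n + 1)) Θ →
          E2half (truncPotential v m) n (sideLength ρ (n + 1)) Θ ≤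
            (⨅ (Θ' : Config2 n → ℂ) (_ : Adm0 n (sideLength ρ (n + 1)) Θ'),
              E2half (truncPotential v m) n (sideLength ρ (n + 1)) Θ') + δ →
          ENNReal.ofReal (1 / 2 + η) ≤
            (‖∫ Z in cell2 n (sideLength ρ (n + 1)), (starRingEnd ℂ) (Θ Z) * Φ Z‖₊ : ENNReal) ^ 2)
    (hS : ∀ v : ℝ → ℝ≥0∞, IsRepulsiveFiniteRange v → ∀ (n : ℕ) (L : ℝ), 0 < L →
      (⨅ (Θ : Config2 n → ℂ) (_ : Adm0 n L Θ), E2half v n L Θ) ≠ ⊤ → ∀ ε : ℝ, 0 < ε →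
        ∃ m₀ : ℕ, ∀ m : ℕ, m₀ ≤ m → (⨅ (Θ : Config2 n → ℂ) (_ : Adm0 n L Θ), E2half v n L Θ) ≤
          (⨅ (Θ : Config2 n → ℂ) (_ : Adm0 n L Θ), E2half (truncPotential v m) n L Θ) + ENNReal.ofReal ε) :
    TorusHalfSwapOverlap :=
  fun v hv => Birth.stub_cruxOfChord v hv (midpointChordAt_of_subs hU hS v hv)

/-- **THE SPLIT: `UniformTruncatedChord → HalfSwapTruncationStability → TorusHalfSwapOverlap`**, the two hypotheses
written VERBATIM as the route items (crux-style inlined `let`s over Literature vocabulary only; they agree with the folded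
reading definitionally, so this is `TorusHalfSwapOverlap_of_subs_folded` re-typed). [folklore] -/
theorem TorusHalfSwapOverlap_of_subs
    (hU : ∀ v : ℝ → ENNReal, IsRepulsiveFiniteRange v → ∃ ρ₀ : ℝ, 0 < ρ₀ ∧ ∀ ρ : ℝ, 0 < ρ → ρ < ρ₀ → ∃ η : ℝ, 0 < η ∧ ∀ᶠ n : ℕ in Filter.atTop, ∃ δ : ENNReal, 0 < δ ∧ ∀ᶠ m : ℕ in Filter.atTop, let w : ℝ → ENNReal := fun r => min (v r) (m : ENNReal); let L : ℝ := sideLength ρ (n + 1); let C2 : Set (Config (n + 1) × Config (n + 1)) := (cellN (n + 1) L) ×ˢ (cellN (n + 1) L); let E2z : (Config (n + 1) × Config (n + 1) → ℂ) → ENNReal := fun Θ => ∫⁻ Z in C2, kineticDensity (fun X => Θ (X, Z.2)) Z.1 + kineticDensity (fun Y => Θ (Z.1, Y)) Z.2 + (periodicInteraction w L Z.1 + periodicInteraction w L Z.2) * (‖Θ Z‖₊ : ENNReal) ^ 2; let E2h : (Config (n + 1) × Config (n + 1) → ℂ) → ENNReal := fun Θ => ∫⁻ Z in C2, (kineticDensity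 (fun X => Θ (X, Z.2)) Z.1 + kineticDensity (fun Y => Θ (Z.1, Y)) Z.2 + (periodicInteraction w L (Fin.tail Z.1) + periodicInteraction w L (Fin.tail Z.2) + ∑ j : Fin n, (2 : ENNReal)⁻¹ * (periodizedPotential w L (Z.1 0 - Z.1 j.succ) + periodizedPotential w L (Z.2 0 - Z.2 j.succ) + periodizedPotential w L (Z.2 0 - Z.1 j.succ) + periodizedPotential w L (Z.1 0 - Z.2 j.succ))) * (‖Θ Z‖₊ : ENNReal) ^ 2); let Adm : (Config (n + 1) × Config (n + 1) → ℂ) → Prop := fun Θ => ContDiff ℝ 1 Θ ∧ (∀ (Z : Config (n + 1) × Config (n + 1)) (i : Fin (n + 1)) (k : Fin 3), Θ (Z.1 + Pi.single i (EuclideanSpace.single k L), Z.2) = Θ Z ∧ Θ (Z.1, Z.2 + Pi.single i (EuclideanSpace.single k L)) = Θ Z) ∧ ∫⁻ Z in C2, (‖Θ Z‖₊ : ENNReal) ^ 2 = 1; ∀ Φ Θ : Config (n + 1) × Config (n + 1) → ℂ, Adm Φ → E2z Φ ≤ (⨅ (Θ' : Config (n + 1) × Config (n + 1) → ℂ) (_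 : Adm Θ'), E2z Θ') + δ → Adm Θ → E2h Θ ≤ (⨅ (Θ' : Config (n + 1) × Config (n + 1) → ℂ) (_ : Adm Θ'), E2h Θ') + δ → ENNReal.ofReal (1 / 2 + η) ≤ (‖∫ Z in C2, (starRingEnd ℂ) (Θ Z) * Φ Z‖₊ : ENNReal) ^ 2)
    (hS : ∀ v : ℝ → ENNReal, IsRepulsiveFiniteRange v → ∀ (n : ℕ) (L : ℝ), 0 < L → let C2 : Set (Config (n + 1) × Config (n + 1)) := (cellN (n + 1) L) ×ˢ (cellN (n + 1) L); let E2h : (ℝ → ENNReal) → (Config (n + 1) × Config (n + 1) → ℂ) → ENNReal := fun w Θ => ∫⁻ Z in C2, (kineticDensity (fun X => Θ (X, Z.2)) Z.1 + kineticDensity (fun Y => Θ (Z.1, Y)) Z.2 + (periodicInteraction w L (Fin.tail Z.1) + periodicInteraction w L (Fin.tail Z.2) + ∑ j : Fin n, (2 : ENNReal)⁻¹ * (periodizedPotential w L (Z.1 0 - Z.1 j.succ) + periodizedPotential w L (Z.2 0 - Z.2 j.succ) + periodizedPotential w L (Z.2 0 - Z.1 j.succ) + periodizedPotential w L (Z.1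 0 - Z.2 j.succ))) * (‖Θ Z‖₊ : ENNReal) ^ 2); let Adm : (Config (n + 1) × Config (n + 1) → ℂ) → Prop := fun Θ => ContDiff ℝ 1 Θ ∧ (∀ (Z : Config (n + 1) × Config (n + 1)) (i : Fin (n + 1)) (k : Fin 3), Θ (Z.1 + Pi.single i (EuclideanSpace.single k L), Z.2) = Θ Z ∧ Θ (Z.1, Z.2 + Pi.single i (EuclideanSpace.single k L)) = Θ Z) ∧ ∫⁻ Z in C2, (‖Θ Z‖₊ : ENNReal) ^ 2 = 1; (⨅ (Θ : Config (n + 1) × Config (n + 1) → ℂ) (_ : Adm Θ), E2h v Θ) ≠ ⊤ → ∀ ε : ℝ, 0 < ε → ∃ m₀ : ℕ, ∀ m : ℕ, m₀ ≤ m → (⨅ (Θ : Config (n + 1) × Config (n + 1) → ℂ) (_ : Adm Θ), E2h v Θ) ≤ (⨅ (Θ : Config (n + 1) × Config (n + 1) → ℂ) (_ : Adm Θ), E2h (fun r => min (v r) (m : ENNReal)) Θ) + ENNReal.ofReal ε) :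
    TorusHalfSwapOverlap :=
  TorusHalfSwapOverlap_of_subs_folded hU hS

end Summit.AtomisticToContinuum.BoseEinsteinCondensation.Cruxes.TorusHalfSwapOverlap.Split

end
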